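import Summits.Ventures.Crystal3D.Theorems.StickyWulffConstantCoaxialWallLawBarlowCoreRigidity
import Summits.Ventures.Crystal3D.Theorems.StickyWulffConstantTextureLiminfTexShadowWordThreading
import HarnessLib

/-!
# NO ENTRY into a clamped BARLOW receiving plate related to the root frame by words: `hPexcl0` at faulted top plates ((β)-lite B2′)
# (lane T, crux `TextureLiminfV5`, stmt-Ventures-23912, line `TexShadow` v8.22, re-targeted `stub_terraceCensus`; 19480-p1 g20; memo BETA-LITE-g20 §4)

HONEST FRAMING. Venture `Summits/Ventures/Crystal3D` (cell `crystal3d-full`), route `route-Ventures-StickyWulffConstant`, helper `--supports` the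
law-v5 crux `TextureLiminfV5` (stmt-Ventures-23912), lane T.  Census-free, standard axioms; nothing about energies; F-C1 not moved.

'…TexShadowWordNoEntry' (p737572) discharged the top-exclusion clause `hPexcl0` of the plate-abstract word net for receiving balls FULL in a frame.
The deep balls of a FAULTED (Barlow) receiving plate are full OR twin readings; this file covers them all at once through 19481-p2's frame lemma
`frame_of_face_occupied` ('…BarlowWindowFrames'): an occupied `60°` face of ANY frame `G` at a deep ball of a clamped Barlow plate `stacking L₂ s₂ σ₂`
forces `G '' S = L₂ '' S` or `G '' S = (basalMirror ≫ L₂) '' S` (`frame_of_face_receivingPlateBall`, the plate lemma transported by the plate isometry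
exactly as in `word_eq_nil_of_face_plateBall`, '…BarlowCoreRigidity').  Hence **`hPexcl0_of_receivingBarlowPlate`**: for word data `(F, u, WF)` whose
root is IN-PLANE for a letter of the word `w₀` relating `F []` to `L₂` AND for a letter of the word `w₀'` relating `F []` to `basalMirror ≫ L₂`, no
well-formed class reads an occupied face at a deep ball of the receiving plate — the hypothesis `hPexcl0` of `word_family_endPairs_plates` /
`word_endPairs_multi_plates` VERBATIM for a receiving core `P₂` of such balls, every state invariant (`word_image_ne_wordFrame_of_inner_zero`, p736971).
WHAT THIS IS NOT: not the count, not the sources, not the certificate; F-C1 not moved.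
-/

noncomputable section

namespace Summit.Ventures.Crystal3D.Theorems

open Summit.Ventures.Crystal3D Finset
open Literature.MathematicalPhysics.StatisticalMechanics (barlowPos barlowStacking IsHaggSeq barlowPos_mem basalMirror)
open Summit.Ventures.Crystal3D.Cruxes.TextureLiminf.TexShadow (E3 stacking)
open scoped InnerProductSpace

section Receiving

variable {σ₂ : ℤ → ℤ} (hσ₂ : IsHaggSeq σ₂) (L₂ : E3 ≃ₗᵢ[ℝ] E3) (s₂ : E3) {X : Finset E3}
  (hsep : ∀ p ∈ X, ∀ p' ∈ X, p ≠ p' → 1 ≤ dist p p') {W : Set E3}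
  (hplate : ∀ p ∈ stacking L₂ s₂ σ₂, p ∈ W → p ∈ X)

include hσ₂ hsep hplate

open scoped Classical in
/-- **An occupied `60°` face of ANY frame at a deep ball of a clamped Barlow plate is a face of one of the plate's two dozens**:
`G '' S = L₂ '' S` or `G '' S = (basalMirror ≫ L₂) '' S`. -/
theorem frame_of_face_receivingPlateBall (k i j : ℤ)
    (hW : ∀ x, dist (L₂ (barlowPos 1 (Real.sqrt (2 / 3)) σ₂ k i j) + s₂) x ≤ 2 → x ∈ W)
    (G : E3 ≃ₗᵢ[ℝ] E3) {a a' a'' : E3} (ha : a ∈ fccSlots) (ha' : a' ∈ fccSlots) (ha'' : a'' ∈ fccSlots)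
    (i1 : ⟪a, a'⟫_ℝ = 1 / 2) (i2 : ⟪a, a''⟫_ℝ = 1 / 2) (i3 : ⟪a', a''⟫_ℝ = 1 / 2)
    (h1 : L₂ (barlowPos 1 (Real.sqrt (2 / 3)) σ₂ k i j) + s₂ + G a ∈ X)
    (h2 : L₂ (barlowPos 1 (Real.sqrt (2 / 3)) σ₂ k i j) + s₂ + G a' ∈ X)
    (h3 : L₂ (barlowPos 1 (Real.sqrt (2 / 3)) σ₂ k i j) + s₂ + G a'' ∈ X) :
    (G : E3 → E3) '' ↑fccSlots = (L₂ : E3 → E3) '' ↑fccSlots ∨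
      (G : E3 → E3) '' ↑fccSlots = ((basalMirror.trans L₂ : E3 ≃ₗᵢ[ℝ] E3) : E3 → E3) '' ↑fccSlots := by
  set q : E3 := barlowPos 1 (Real.sqrt (2 / 3)) σ₂ k i j with hq
  obtain ⟨-, hXm⟩ := plateBall_model_hyps L₂ s₂ hsep hplate k i j hW
  set G' : E3 ≃ₗᵢ[ℝ] E3 := G.trans L₂.symm with hG'
  have hGG' : ∀ x, G x = L₂ (G' x) := fun x => by
    rw [hG', LinearIsometryEquiv.trans_apply, LinearIsometryEquiv.apply_symm_apply]
  -- pull an occupied slot back to the model configuration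
  have pull : ∀ x : E3, L₂ q + s₂ + G x ∈ X → q + G' x ∈ X.image fun y => L₂.symm (y - s₂) := by
    intro x hx
    refine mem_image.2 ⟨L₂ q + s₂ + G x, hx, ?_⟩
    have : L₂ q + s₂ + G x - s₂ = L₂ (q + G' x) := by rw [map_add, ← hGG']; abel
    rw [this, LinearIsometryEquiv.symm_apply_apply]
  have himg : (G : E3 → E3) '' ↑fccSlots = (L₂ : E3 → E3) '' ((G' : E3 → E3) '' ↑fccSlots) := by
    rw [Set.image_image]
    exact Set.image_congr fun x _ => hGG' x
  rcases frame_of_face_occupied hσ₂ (barlowPos_mem k i j) hXm G' ha ha' ha'' i1 i2 i3 (pull a h1) (pull a' h2) (pull a'' h3)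
    with h | h
  · left
    rw [himg, h]
  · right
    rw [himg, h, Set.image_image]
    rfl

variable {F : List E3 → (E3 ≃ₗᵢ[ℝ] E3)} {u : List E3 → E3} {WF : List E3 → Prop}
  (hFc : ∀ μ κ, F (μ :: κ) = ((ℝ ∙ μ)ᗮ.reflection).trans (F κ))
  (huc : ∀ μ κ, u (μ :: κ) = -u κ)
  (hWFc : ∀ μ κ, WF (μ :: κ) ↔ (WF κ ∧ ‖μ‖ = 1 ∧
    (∀ w ∈ fccSlots, ⟪w, μ⟫_ℝ = 0 ∨ ⟪w, μ⟫_ℝ = Real.sqrt (2 / 3) ∨ ⟪w, μ⟫_ℝ = -Real.sqrt (2 / 3)) ∧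
    ⟪u κ, μ⟫_ℝ = Real.sqrt (2 / 3) ∧ ∀ μ' κ', κ = μ' :: κ' → μ' ≠ -μ))
  {w₀ : List E3}
  (hw₀l : ∀ μ ∈ w₀, ‖μ‖ = 1 ∧
    ∀ w ∈ fccSlots, ⟪w, μ⟫_ℝ = 0 ∨ ⟪w, μ⟫_ℝ = Real.sqrt (2 / 3) ∨ ⟪w, μ⟫_ℝ = -Real.sqrt (2 / 3))
  (hw₀c : List.IsChain (fun μ μ' => ⟪μ, μ'⟫_ℝ = 1 / 3 ∨ ⟪μ, μ'⟫_ℝ = -1 / 3) w₀)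
  {m : E3} (hm : m ∈ w₀) (horth : ⟪u [], m⟫_ℝ = 0)
  (hL₂ : ((L₂ : E3 ≃ₗᵢ[ℝ] E3) : E3 → E3) '' ↑fccSlots = (wordFrame (F []) w₀ : E3 → E3) '' ↑fccSlots)
  {w₀' : List E3}
  (hw₀'l : ∀ μ ∈ w₀', ‖μ‖ = 1 ∧
    ∀ w ∈ fccSlots, ⟪w, μ⟫_ℝ = 0 ∨ ⟪w, μ⟫_ℝ = Real.sqrt (2 / 3) ∨ ⟪w, μ⟫_ℝ = -Real.sqrt (2 / 3))
  (hw₀'c : List.IsChain (fun μ μ' => ⟪μ, μ'⟫_ℝ = 1 / 3 ∨ ⟪μ, μ'⟫_ℝ = -1 / 3) w₀')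
  {m' : E3} (hm' : m' ∈ w₀') (horth' : ⟪u [], m'⟫_ℝ = 0)
  (hL₂' : ((basalMirror.trans L₂ : E3 ≃ₗᵢ[ℝ] E3) : E3 → E3) '' ↑fccSlots = (wordFrame (F []) w₀' : E3 → E3) '' ↑fccSlots)

include hFc huc hWFc hw₀l hw₀c hm horth hL₂ hw₀'l hw₀'c hm' horth' hL₂'

open scoped Classical in
/-- **`hPexcl0` at a clamped BARLOW receiving plate** whose two dozens are word images of the root dozen, the root being in-plane for a letter of each
word: no well-formed class reads an occupied `60°` face at a deep plate ball — for every receiving core `P₂` of deep balls and every state invariant. -/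
theorem hPexcl0_of_receivingBarlowPlate (P₂ : Finset E3)
    (hP₂ : ∀ b ∈ P₂, ∃ k i j : ℤ, b = L₂ (barlowPos 1 (Real.sqrt (2 / 3)) σ₂ k i j) + s₂ ∧ ∀ x, dist b x ≤ 2 → x ∈ W)
    (P : E3 × List E3 → Prop) :
    ∀ (b : E3) (κ : List E3), WF κ → P (b, κ) → b ∈ P₂ →
      (∃ a ∈ fccSlots, ∃ a' ∈ fccSlots, ∃ a'' ∈ fccSlots,
        ⟪a, a'⟫_ℝ = 1 / 2 ∧ ⟪a, a''⟫_ℝ = 1 / 2 ∧ ⟪a', a''⟫_ℝ = 1 / 2 ∧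
        b + F κ a ∈ X ∧ b + F κ a' ∈ X ∧ b + F κ a'' ∈ X) → False := by
  intro b κ hκ _ hb htri
  obtain ⟨k, i, j, rfl, hW⟩ := hP₂ b hb
  obtain ⟨a, ha, a', ha', a'', ha'', i1, i2, i3, h1, h2, h3⟩ := htri
  rcases frame_of_face_receivingPlateBall hσ₂ L₂ s₂ hsep hplate k i j hW (F κ) ha ha' ha'' i1 i2 i3 h1 h2 h3 with h | h
  · rw [hL₂] at h
    exact word_image_ne_wordFrame_of_inner_zero hFc huc hWFc hw₀l hw₀c hm horth hκ h
  · rw [hL₂'] at h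
    exact word_image_ne_wordFrame_of_inner_zero hFc huc hWFc hw₀'l hw₀'c hm' horth' hκ h

end Receiving

end Summit.Ventures.Crystal3D.Theorems

end
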